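import Mathlib
import Summits.Ventures.PercRepro2.Defs
import Summits.Ventures.PercRepro2.Graph
import Summits.Ventures.PercRepro2.OneColourSwitch
import Summits.Ventures.PercRepro2.OneColourSwitchFibre

/-!
# The `m9` sign form on a typed fibre, and the pendant class theorem in that form (blind cell
PercRepro2, p3 g15, 2026-08-27; `proofs/P3-CPNC.md` §9a)

On a fibre (free edges `F` coloured complementarily, the rest fixed by `z` in both colours) the sign
form `Σ_{Sep} σ_pq σ_rs` equals `2 · (#m9LeftF − #m9RightF)` by the fibre flip `flipOn F`, which is an
involution of the fibre (`flipOn_mem_fibre`); with `OneColourSwitchFibre.card_m9LeftF_le_card_m9RightF_of_pendant`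
this gives `m9` in sign form on every fibre whose `r, s` are pendant with free edges.  Own work;
standard axioms.
-/

namespace Summit.Ventures.PercRepro2

namespace OneColourSwitch

open Finset Classical

variable {V : Type*} {E : Type*}
variable (ends : E → Sym2 V)

/-- The colour preference on a fibre. -/
noncomputable def sigmaF (F : Set E) (ω : Config E) (a b : V) : ℤ :=
  (if Conn ends ω a b then 1 else 0) - (if Conn ends (flipOn F ω) a b then 1 else 0)

/-- The `m9` sign-form sum on the fibre. -/
noncomputable def m9SignSumF [Fintype E] [DecidableEq E] (F : Set E) (z : Config E) (p q r s : V) : ℤ :=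
  ∑ ω : Config E, if ω ∈ fibre F z ∧ sep2F ends F p q r s ω then
    sigmaF ends F ω p q * sigmaF ends F ω r s else 0

section Lemmas

variable {ends} {F : Set E}

omit ends in
/-- `flipOn F` is an involution. -/
@[simp] lemma flipOn_flipOn (ω : Config E) : flipOn F (flipOn F ω) = ω := by
  funext e
  by_cases h : e ∈ F
  · rw [flipOn_of_mem h, flipOn_of_mem h, Bool.not_not]
  · rw [flipOn_of_notMem h, flipOn_of_notMem h]

omit ends in
/-- `flipOn F` preserves the fibre. -/
lemma flipOn_mem_fibre {z : Config E} {ω : Config E} : flipOn F ω ∈ fibre F z ↔ ω ∈ fibre F z := by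
  constructor
  · intro h e he
    have := h e he
    rwa [flipOn_of_notMem he] at this
  · intro h e he
    rw [flipOn_of_notMem he]
    exact h e he

/-- The two-colour separation on the fibre is flip-invariant. -/
lemma sep2F_flipOn {p q r s : V} {ω : Config E} :
    sep2F ends F p q r s (flipOn F ω) ↔ sep2F ends F p q r s ω := by
  simp only [sep2F, flipOn_flipOn]
  exact and_comm

omit ends in
/-- The fibre flip as a permutation. -/
noncomputable def flipOnPerm (F : Set E) : Equiv.Perm (Config E) :=
  Function.Involutive.toPerm (flipOn F) flipOn_flipOn

/-- The pointwise expansion of the fibre sign kernel. -/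
lemma signF_kernel_eq {z : Config E} {p q r s : V} (ω : Config E) :
    (if ω ∈ fibre F z ∧ sep2F ends F p q r s ω then sigmaF ends F ω p q * sigmaF ends F ω r s
      else 0) =
      ((if ω ∈ fibre F z ∧ sep2F ends F p q r s ω ∧ Conn ends ω p q ∧ Conn ends ω r s then (1 : ℤ)
          else 0) -
        (if ω ∈ fibre F z ∧ sep2F ends F p q r s ω ∧ Conn ends ω p q ∧
            Conn ends (flipOn F ω) r s then 1 else 0)) -
      ((if ω ∈ fibre F z ∧ sep2F ends F p q r s ω ∧ Conn ends (flipOn F ω) p q ∧ Conn ends ω r s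
          then (1 : ℤ) else 0) -
        (if ω ∈ fibre F z ∧ sep2F ends F p q r s ω ∧ Conn ends (flipOn F ω) p q ∧
            Conn ends (flipOn F ω) r s then 1 else 0)) := by
  unfold sigmaF
  by_cases h0 : ω ∈ fibre F z ∧ sep2F ends F p q r s ω <;> by_cases h1 : Conn ends ω p q <;>
    by_cases h2 : Conn ends (flipOn F ω) p q <;> by_cases h3 : Conn ends ω r s <;>
    by_cases h4 : Conn ends (flipOn F ω) r s <;> simp [h0, h1, h2, h3, h4]

/-- The flip exchanges the colour patterns on the fibre. -/
lemma sum_flipF_pattern [Fintype E] [DecidableEq E] {z : Config E} {p q r s : V} (A B A' B' : Config E → Prop)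
    (hA : ∀ ω, A ω ↔ A' (flipOn F ω)) (hB : ∀ ω, B ω ↔ B' (flipOn F ω)) :
    (∑ ω : Config E, if ω ∈ fibre F z ∧ sep2F ends F p q r s ω ∧ A ω ∧ B ω then (1 : ℤ) else 0) =
      ∑ ω : Config E, if ω ∈ fibre F z ∧ sep2F ends F p q r s ω ∧ A' ω ∧ B' ω then (1 : ℤ)
        else 0 := by
  refine Fintype.sum_equiv (flipOnPerm F) _ _ (fun ω => ?_)
  simp only [flipOnPerm, Function.Involutive.coe_toPerm, flipOn_mem_fibre, sep2F_flipOn, hA, hB]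

end Lemmas

section Main

variable [Fintype E] [DecidableEq E]

/-- **The fibre sign form is twice the primed difference.** -/
theorem m9SignSumF_eq (F : Set E) (z : Config E) (p q r s : V) :
    m9SignSumF ends F z p q r s =
      2 * (((univ.filter (fun ω : Config E => ω ∈ m9LeftF ends F z p q r s)).card : ℤ) -
        (univ.filter (fun ω : Config E => ω ∈ m9RightF ends F z p q r s)).card) := by
  unfold m9SignSumF
  simp only [signF_kernel_eq, Finset.sum_sub_distrib]
  have hWW := sum_flipF_pattern (ends := ends) (F := F) (z := z) (p := p) (q := q) (r := r) (s := s)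
    (fun ω => Conn ends (flipOn F ω) p q) (fun ω => Conn ends (flipOn F ω) r s)
    (fun ω => Conn ends ω p q) (fun ω => Conn ends ω r s)
    (fun ω => Iff.rfl) (fun ω => Iff.rfl)
  have hWY := sum_flipF_pattern (ends := ends) (F := F) (z := z) (p := p) (q := q) (r := r) (s := s)
    (fun ω => Conn ends (flipOn F ω) p q) (fun ω => Conn ends ω r s)
    (fun ω => Conn ends ω p q) (fun ω => Conn ends (flipOn F ω) r s)
    (fun ω => Iff.rfl) (fun ω => by rw [flipOn_flipOn])
  rw [hWW, hWY, Finset.sum_boole, Finset.sum_boole]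
  have e1 : (univ.filter (fun ω : Config E => ω ∈ m9LeftF ends F z p q r s)) =
      univ.filter (fun ω : Config E => ω ∈ fibre F z ∧ sep2F ends F p q r s ω ∧
        Conn ends ω p q ∧ Conn ends ω r s) := by
    ext ω; simp only [Finset.mem_filter, Finset.mem_univ, true_and, m9LeftF, Set.mem_setOf_eq]
  have e2 : (univ.filter (fun ω : Config E => ω ∈ m9RightF ends F z p q r s)) =
      univ.filter (fun ω : Config E => ω ∈ fibre F z ∧ sep2F ends F p q r s ω ∧
        Conn ends ω p q ∧ Conn ends (flipOn F ω) r s) := by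
    ext ω; simp only [Finset.mem_filter, Finset.mem_univ, true_and, m9RightF, Set.mem_setOf_eq]
  rw [e1, e2]
  ring

/-- **`m9` in sign form on every typed fibre with pendant `r, s`** (their single edges free). -/
theorem m9SignSumF_nonpos_of_pendant (F : Set E) (z : Config E) {p q r s : V} {e₁ e₂ : E}
    (hr : Pendant ends r e₁) (hs : Pendant ends s e₂) (hF₁ : e₁ ∈ F) (hF₂ : e₂ ∈ F)
    (hpr : p ≠ r) (hps : p ≠ s) (hqr : q ≠ r) (hqs : q ≠ s) (hrs : r ≠ s) :
    m9SignSumF ends F z p q r s ≤ 0 := by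
  rw [m9SignSumF_eq]
  have h := card_m9LeftF_le_card_m9RightF_of_pendant (ends := ends) F z hr hs hF₁ hF₂ hpr hps hqr
    hqs hrs
  have h' : ((univ.filter (fun ω : Config E => ω ∈ m9LeftF ends F z p q r s)).card : ℤ) ≤
      (univ.filter (fun ω : Config E => ω ∈ m9RightF ends F z p q r s)).card := by exact_mod_cast h
  linarith

end Main

end OneColourSwitch

end Summit.Ventures.PercRepro2
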